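import Literature.Topology.FourManifolds.IndefiniteFoldModel
import HarnessLib

/-!
# Fibres of the indefinite fold: connected on one side, two sheets on the other

Topic `Literature/Topology/FourManifolds`.  The fibres of the indefinite fold model
`F(t, x₁, x₂, x₃) = (t, x₁² + x₂² - x₃²)` (`indefiniteFoldMap`, `IndefiniteFoldModel.lean`)
over a point `(t, s)` of the target are the level sets `{x₁² + x₂² - x₃² = s}` in the
hyperplane `{x₀ = t}`: a one-sheeted hyperboloid (a tube) for `s > 0`, the cone for `s = 0`,
and a two-sheeted hyperboloid for `s < 0`.  This is the local content of the arrow on the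
round image of a base diagram — Baykur–Saeki 2017, §2.1, p. 6: *"the image of any indefinite
fold arc or circle is normally oriented by an arrow, which indicates the direction in which the
topology of a fiber changes by a `2`–handle attachment when crossing over the fold from one side
to the other. This means that a generic fiber over the region the arrow starts, if connected,
has one higher genus than the generic fiber over the region the arrow points into"* — the fibre
is connected over one side of the fold and falls into two pieces (locally) over the other.
Everything is PROVED on the model; no named fact.

* `foldFibre t s` and `mem_foldFibre_iff_indefiniteFoldMap` — the fibre of the model over `(t, s)`;
* `isPathConnected_foldFibre_of_nonneg` — **for `s ≥ 0` the fibre is path connected** (image of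
  the continuous parametrisation `(θ, h) ↦ (t, √(s + h²) cos θ, √(s + h²) sin θ, h)`);
* `foldFibre_eq_union_of_neg`, `isPathConnected_foldFibre_inter_pos`,
  `isPathConnected_foldFibre_inter_neg`, `not_isPreconnected_foldFibre_of_neg` — **for `s < 0`
  the fibre is the disjoint union of the two sheets `x₃ > 0` and `x₃ < 0`**, each path connected
  (graphs of `±√(x₁² + x₂² - s)`), and is not connected.

## References

* R. İ. Baykur, O. Saeki, *Simplifying indefinite fibrations on 4-manifolds*, arXiv:1705.11169
  (Trans. AMS 376, 2023), §2.1 (base diagrams, higher and lower sides). [BaykurSaeki2017]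
-/

noncomputable section

open Set Function

namespace Literature.Topology.FourManifolds

/-- Local notation: `𝔼 n` is the model Euclidean space `EuclideanSpace ℝ (Fin n)`. -/
local notation "𝔼 " n:arg => EuclideanSpace ℝ (Fin n)

/-! ### The fibres of the model -/

/-- **The fibre of the indefinite fold over `(t, s)`**: the level set
`{x₀ = t, x₁² + x₂² - x₃² = s}` of `ℝ⁴`. [folklore] -/
def foldFibre (t s : ℝ) : Set (𝔼 4) :=
  {x | x 0 = t ∧ x 1 ^ 2 + x 2 ^ 2 - x 3 ^ 2 = s}

/-- Membership in the fibre, unfolded. [folklore] -/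
theorem mem_foldFibre_iff {t s : ℝ} {x : 𝔼 4} :
    x ∈ foldFibre t s ↔ x 0 = t ∧ x 1 ^ 2 + x 2 ^ 2 - x 3 ^ 2 = s :=
  Iff.rfl

/-- The fibre `foldFibre t s` IS the preimage of the point `(t, s)` under the fold model.
[folklore] -/
theorem mem_foldFibre_iff_indefiniteFoldMap {t s : ℝ} {x : 𝔼 4} :
    x ∈ foldFibre t s ↔ indefiniteFoldMap x = WithLp.toLp 2 ![t, s] := by
  rw [mem_foldFibre_iff]
  constructor
  · rintro ⟨h0, h1⟩
    ext i
    fin_cases i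
    · simpa using h0
    · simpa using h1
  · intro h
    exact ⟨by simpa using congrArg (fun w : 𝔼 2 => w 0) h,
      by simpa using congrArg (fun w : 𝔼 2 => w 1) h⟩

/-! ### The higher side `s ≥ 0`: a connected fibre -/

/-- The parametrisation `(θ, h) ↦ (t, √(s + h²) cos θ, √(s + h²) sin θ, h)` of the fibre over
`(t, s)`, `s ≥ 0` (a tube for `s > 0`, the cone for `s = 0`). [folklore] -/
def foldTube (t s : ℝ) (p : ℝ × ℝ) : 𝔼 4 :=
  WithLp.toLp 2 ![t, Real.sqrt (s + p.2 ^ 2) * Real.cos p.1, Real.sqrt (s + p.2 ^ 2) * Real.sin p.1,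
    p.2]

/-- The tube parametrisation is continuous. [folklore] -/
theorem continuous_foldTube (t s : ℝ) : Continuous (foldTube t s) := by
  have hr : Continuous fun p : ℝ × ℝ => Real.sqrt (s + p.2 ^ 2) :=
    Real.continuous_sqrt.comp (continuous_const.add (continuous_snd.pow 2))
  refine (PiLp.continuous_toLp 2 _).comp ?_
  refine continuous_pi fun i => ?_
  fin_cases i
  · exact continuous_const
  · exact hr.mul (Real.continuous_cos.comp continuous_fst)
  · exact hr.mul (Real.continuous_sin.comp continuous_fst)
  · exact continuous_snd

/-- For `s ≥ 0` the tube parametrisation lands in the fibre. [folklore] -/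
theorem foldTube_mem_foldFibre {s : ℝ} (hs : 0 ≤ s) (t : ℝ) (p : ℝ × ℝ) :
    foldTube t s p ∈ foldFibre t s := by
  have hsq : Real.sqrt (s + p.2 ^ 2) ^ 2 = s + p.2 ^ 2 := Real.sq_sqrt (by positivity)
  refine ⟨by simp [foldTube], ?_⟩
  simp only [foldTube, PiLp.toLp_apply, Matrix.cons_val_one, Matrix.cons_val, mul_pow]
  linear_combination (Real.cos p.1 ^ 2 + Real.sin p.1 ^ 2) * hsq +
    (s + p.2 ^ 2) * Real.cos_sq_add_sin_sq p.1

/-- **For `s ≥ 0` the tube parametrisation is onto the fibre**: a point with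
`x₁² + x₂² = s + x₃² = r²` is `(t, r cos θ, r sin θ, x₃)` (`r = 0` forces `x₁ = x₂ = 0`).
[folklore] -/
theorem foldFibre_subset_range_foldTube {s : ℝ} (hs : 0 ≤ s) (t : ℝ) :
    foldFibre t s ⊆ range (foldTube t s) := by
  rintro x ⟨h0, hQ⟩
  set r := Real.sqrt (s + x 3 ^ 2) with hr_def
  have hr0 : 0 ≤ r := Real.sqrt_nonneg _
  have hr2 : r ^ 2 = x 1 ^ 2 + x 2 ^ 2 := by
    rw [hr_def, Real.sq_sqrt (by positivity)]
    linarith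
  rcases eq_or_lt_of_le hr0 with hr | hr
  · -- `r = 0`: then `x₁ = x₂ = 0` and any angle works
    have h1 : x 1 = 0 := by nlinarith [sq_nonneg (x 1), sq_nonneg (x 2)]
    have h2 : x 2 = 0 := by nlinarith [sq_nonneg (x 1), sq_nonneg (x 2)]
    refine ⟨(0, x 3), ?_⟩
    ext i
    fin_cases i
    · simpa [foldTube] using h0.symm
    · simp [foldTube, ← hr_def, ← hr, h1]
    · simp [foldTube, h2]
    · simp [foldTube]
  · -- `r > 0`: read the angle of the unit vector `(x₁, x₂)/r`
    set z : ℂ := ⟨x 1 / r, x 2 / r⟩ with hz_def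
    have hz2 : ‖z‖ ^ 2 = 1 := by
      rw [Complex.sq_norm, Complex.normSq_apply]
      simp only [hz_def]
      field_simp
      linarith
    have hz1 : ‖z‖ = 1 := (pow_eq_one_iff_of_nonneg (norm_nonneg z) two_ne_zero).mp hz2
    obtain ⟨θ, hθ⟩ := (Complex.norm_eq_one_iff z).mp hz1
    have hre : Real.cos θ = x 1 / r := by rw [← Complex.exp_ofReal_mul_I_re θ, hθ]
    have him : Real.sin θ = x 2 / r := by rw [← Complex.exp_ofReal_mul_I_im θ, hθ]
    refine ⟨(θ, x 3), ?_⟩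
    ext i
    fin_cases i
    · simpa [foldTube] using h0.symm
    · simp [foldTube, ← hr_def, hre, mul_div_cancel₀ _ hr.ne']
    · simp [foldTube, ← hr_def, him, mul_div_cancel₀ _ hr.ne']
    · simp [foldTube]

/-- For `s ≥ 0` the fibre is exactly the image of the tube parametrisation. [folklore] -/
theorem range_foldTube_eq {s : ℝ} (hs : 0 ≤ s) (t : ℝ) : range (foldTube t s) = foldFibre t s :=
  Subset.antisymm (by rintro _ ⟨p, rfl⟩; exact foldTube_mem_foldFibre hs t p)
    (foldFibre_subset_range_foldTube hs t)

/-- **Over the higher side the fibre of the fold is connected**: for `s ≥ 0` the level set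
`{x₀ = t, x₁² + x₂² - x₃² = s}` is path connected (a tube for `s > 0`, the cone for `s = 0`)
— the side of the arrow where *"a generic fiber … has one higher genus"* (Baykur–Saeki 2017,
§2.1). [cite: BaykurSaeki2017, §2.1] -/
theorem isPathConnected_foldFibre_of_nonneg {s : ℝ} (hs : 0 ≤ s) (t : ℝ) :
    IsPathConnected (foldFibre t s) := by
  rw [← range_foldTube_eq hs t, ← image_univ]
  exact isPathConnected_univ.image (continuous_foldTube t s)

/-! ### The lower side `s < 0`: two sheets -/

/-- The sheet parametrisation `(a, b) ↦ (t, a, b, ε √(a² + b² - s))` (`ε = ±1`) of the fibre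
over `(t, s)`, `s < 0`. [folklore] -/
def foldSheet (t s ε : ℝ) (p : ℝ × ℝ) : 𝔼 4 :=
  WithLp.toLp 2 ![t, p.1, p.2, ε * Real.sqrt (p.1 ^ 2 + p.2 ^ 2 - s)]

/-- The sheet parametrisation is continuous. [folklore] -/
theorem continuous_foldSheet (t s ε : ℝ) : Continuous (foldSheet t s ε) := by
  have hr : Continuous fun p : ℝ × ℝ => ε * Real.sqrt (p.1 ^ 2 + p.2 ^ 2 - s) :=
    continuous_const.mul (Real.continuous_sqrt.comp
      (((continuous_fst.pow 2).add (continuous_snd.pow 2)).sub continuous_const))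
  refine (PiLp.continuous_toLp 2 _).comp ?_
  refine continuous_pi fun i => ?_
  fin_cases i
  · exact continuous_const
  · exact continuous_fst
  · exact continuous_snd
  · exact hr

/-- For `s < 0` (indeed `s ≤ 0`) and `ε = ±1` the sheet parametrisation lands in the fibre.
[folklore] -/
theorem foldSheet_mem_foldFibre {s ε : ℝ} (hs : s ≤ 0) (hε : ε ^ 2 = 1) (t : ℝ) (p : ℝ × ℝ) :
    foldSheet t s ε p ∈ foldFibre t s := by
  have hsq : Real.sqrt (p.1 ^ 2 + p.2 ^ 2 - s) ^ 2 = p.1 ^ 2 + p.2 ^ 2 - s :=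
    Real.sq_sqrt (by nlinarith [sq_nonneg p.1, sq_nonneg p.2])
  refine ⟨by simp [foldSheet], ?_⟩
  simp only [foldSheet, PiLp.toLp_apply, Matrix.cons_val_one, Matrix.cons_val, mul_pow, hε, hsq]
  simp

/-- **For `s < 0` the fibre is the union of the two sheets `x₃ > 0` and `x₃ < 0`**, the images
of the two sheet parametrisations (`x₃² = x₁² + x₂² - s ≥ -s > 0` rules out `x₃ = 0`).
[folklore] -/
theorem foldFibre_eq_union_of_neg {s : ℝ} (hs : s < 0) (t : ℝ) :
    foldFibre t s = range (foldSheet t s 1) ∪ range (foldSheet t s (-1)) := by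
  have hsq : ∀ a b : ℝ, Real.sqrt (a ^ 2 + b ^ 2 - s) ^ 2 = a ^ 2 + b ^ 2 - s := fun a b =>
    Real.sq_sqrt (by nlinarith [sq_nonneg a, sq_nonneg b])
  apply Subset.antisymm
  · rintro x ⟨h0, hQ⟩
    have h3 : x 3 ^ 2 = Real.sqrt (x 1 ^ 2 + x 2 ^ 2 - s) ^ 2 := by rw [hsq]; linarith
    rcases sq_eq_sq_iff_eq_or_eq_neg.mp h3 with h | h
    · left
      refine ⟨(x 1, x 2), ?_⟩
      ext i
      fin_cases i
      · simpa [foldSheet] using h0.symm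
      · simp [foldSheet]
      · simp [foldSheet]
      · simpa [foldSheet] using h.symm
    · right
      refine ⟨(x 1, x 2), ?_⟩
      ext i
      fin_cases i
      · simpa [foldSheet] using h0.symm
      · simp [foldSheet]
      · simp [foldSheet]
      · simpa [foldSheet] using h.symm
  · rintro x (⟨p, rfl⟩ | ⟨p, rfl⟩)
    · exact foldSheet_mem_foldFibre hs.le (by norm_num) t p
    · exact foldSheet_mem_foldFibre hs.le (by norm_num) t p

/-- On the fibre over `(t, s)` with `s < 0` the coordinate `x₃` never vanishes. [folklore] -/
theorem apply_three_ne_zero_of_mem_foldFibre {t s : ℝ} (hs : s < 0) {x : 𝔼 4}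
    (hx : x ∈ foldFibre t s) : x 3 ≠ 0 := by
  intro h3
  obtain ⟨-, hQ⟩ := hx
  rw [h3] at hQ
  nlinarith [sq_nonneg (x 1), sq_nonneg (x 2)]

/-- The sheet `ε = 1` is the part of the fibre with `x₃ > 0` (`s < 0`). [folklore] -/
theorem range_foldSheet_one_eq {s : ℝ} (hs : s < 0) (t : ℝ) :
    range (foldSheet t s 1) = foldFibre t s ∩ {x | 0 < x 3} := by
  have hpos : ∀ a b : ℝ, 0 < Real.sqrt (a ^ 2 + b ^ 2 - s) := fun a b =>
    Real.sqrt_pos.mpr (by nlinarith [sq_nonneg a, sq_nonneg b])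
  apply Subset.antisymm
  · rintro _ ⟨p, rfl⟩
    exact ⟨foldSheet_mem_foldFibre hs.le (by norm_num) t p, by simpa [foldSheet] using hpos p.1 p.2⟩
  · rintro x ⟨hx, h3⟩
    rw [foldFibre_eq_union_of_neg hs t] at hx
    rcases hx with hx | ⟨p, rfl⟩
    · exact hx
    · exfalso
      have : (foldSheet t s (-1) p) 3 < 0 := by
        simpa [foldSheet] using hpos p.1 p.2
      exact lt_irrefl _ (h3.trans this)

/-- The sheet `ε = -1` is the part of the fibre with `x₃ < 0` (`s < 0`). [folklore] -/
theorem range_foldSheet_neg_one_eq {s : ℝ} (hs : s < 0) (t : ℝ) :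
    range (foldSheet t s (-1)) = foldFibre t s ∩ {x | x 3 < 0} := by
  have hpos : ∀ a b : ℝ, 0 < Real.sqrt (a ^ 2 + b ^ 2 - s) := fun a b =>
    Real.sqrt_pos.mpr (by nlinarith [sq_nonneg a, sq_nonneg b])
  apply Subset.antisymm
  · rintro _ ⟨p, rfl⟩
    exact ⟨foldSheet_mem_foldFibre hs.le (by norm_num) t p, by simpa [foldSheet] using hpos p.1 p.2⟩
  · rintro x ⟨hx, h3⟩
    rw [foldFibre_eq_union_of_neg hs t] at hx
    rcases hx with ⟨p, rfl⟩ | hx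
    · exfalso
      have : 0 < (foldSheet t s 1 p) 3 := by simpa [foldSheet] using hpos p.1 p.2
      exact lt_irrefl _ (h3.trans this)
    · exact hx

/-- **Each sheet is path connected** (`s < 0`, upper sheet `x₃ > 0`): the image of `ℝ²`
under the continuous graph map `(a, b) ↦ (t, a, b, √(a² + b² - s))`. [folklore] -/
theorem isPathConnected_foldFibre_inter_pos {s : ℝ} (hs : s < 0) (t : ℝ) :
    IsPathConnected (foldFibre t s ∩ {x | 0 < x 3}) := by
  rw [← range_foldSheet_one_eq hs t, ← image_univ]
  exact isPathConnected_univ.image (continuous_foldSheet t s 1)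

/-- **Each sheet is path connected** (`s < 0`, lower sheet `x₃ < 0`). [folklore] -/
theorem isPathConnected_foldFibre_inter_neg {s : ℝ} (hs : s < 0) (t : ℝ) :
    IsPathConnected (foldFibre t s ∩ {x | x 3 < 0}) := by
  rw [← range_foldSheet_neg_one_eq hs t, ← image_univ]
  exact isPathConnected_univ.image (continuous_foldSheet t s (-1))

/-- **Over the lower side the fibre of the fold is disconnected**: for `s < 0` the level set
`{x₀ = t, x₁² + x₂² - x₃² = s}` is not preconnected — the continuous coordinate `x₃` takes a
positive value on the upper sheet and a negative value on the lower sheet but never the value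
`0` (intermediate value theorem).  Crossing the fold from `s > 0` to `s < 0` the connected tube
falls into two sheets: locally, this is the `2`–handle attachment / compression of the fibre
recorded by the arrow of a base diagram (Baykur–Saeki 2017, §2.1). [cite: BaykurSaeki2017, §2.1] -/
theorem not_isPreconnected_foldFibre_of_neg {s : ℝ} (hs : s < 0) (t : ℝ) :
    ¬ IsPreconnected (foldFibre t s) := by
  intro hconn
  -- one point on each sheet
  have ha : foldSheet t s (-1) (0, 0) ∈ foldFibre t s := foldSheet_mem_foldFibre hs.le (by norm_num) t _
  have hb : foldSheet t s 1 (0, 0) ∈ foldFibre t s := foldSheet_mem_foldFibre hs.le (by norm_num) t _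
  have hpos : 0 < Real.sqrt (0 ^ 2 + 0 ^ 2 - s) := Real.sqrt_pos.mpr (by nlinarith)
  have hfa : (foldSheet t s (-1) (0, 0)) 3 < 0 := by simpa [foldSheet] using hpos
  have hfb : 0 < (foldSheet t s 1 (0, 0)) 3 := by simpa [foldSheet] using hpos
  have hcont : ContinuousOn (fun x : 𝔼 4 => x 3) (foldFibre t s) :=
    (EuclideanSpace.proj (3 : Fin 4) : 𝔼 4 →L[ℝ] ℝ).continuous.continuousOn
  have h0 : (0 : ℝ) ∈ Icc ((foldSheet t s (-1) (0, 0)) 3) ((foldSheet t s 1 (0, 0)) 3) :=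
    ⟨hfa.le, hfb.le⟩
  obtain ⟨x, hx, hx3⟩ := hconn.intermediate_value ha hb hcont h0
  exact apply_three_ne_zero_of_mem_foldFibre hs hx hx3

end Literature.Topology.FourManifolds

end
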